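import Summits.HubbardSuperconductivity.HubbardSuperconductivity.Theorems.BalabanIRBirGroundStateAverageLROSoftminThermalFloorOfGroundStates

/-!
# Route BalabanIR — crux `BirGroundStateAverageLRO` (item `stmt-HubbardSuperconductivity-2079`), line `Sketch` (softmin-pair-penalty): the engine socket is EXACTLY every-ground-state `d`-wave order

Third of three files. On the `L × L` Hubbard torus with `A = Δ_d†Δ_d` (`Δ_d = pairField
dWaveFormFactor L`) and the joint sector `S = (2⌊(1-δ)L²/2⌋, S^z = 0)`:

* `penalisedHubbard_groundEigenspace_ne_bot` — the penalised `hubbardTorus 2 L 1 U + g·A` has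
  ground states in `S` (it is Hermitian and block diagonal in `(N↑, N↓)`; `sector_groundState`);
* `freeFloorAt_of_everyGroundStateLRO` — if every normalised sector ground state of
  `hubbardTorus 2 L 1 U` has `Re⟨ψ, Aψ⟩ ≥ yL⁴` then the data of the free socket hold at `(U, L)`
  with floor `y/8`: some `β > 0`, `κ = gL⁴ > 0`, `σ = L² log 4`, `4σ ≤ βκ(y/8)`, and
  `(y/8)L⁴·Re tr(P_S e^{-βK}) ≤ Re tr(P_S e^{-βK} A)`, `K = H + (κ/L⁴)A`
  (`exists_penalisedThermalFloor_of_groundStateFloor` with `M = (C_d L²)²`);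
* `freeFloorWindow_of_everyGroundStateLRO` (registered lead-held stub) and
  `everyGroundStateLRO_of_freeFloorWindow` (the landed transfer direction,
  `everyGroundState_of_freeFloorAt`) — on a window of couplings, eventually in even `L`:
  every-GS order `y` ⇒ socket data `y/8`, and socket data `x` ⇒ every-GS order `x/2`; packaged as
  the logical equivalence `exists_freeFloorWindow_iff_exists_everyGroundStateLRO`
  (`∃ x > 0, socket data` ↔ `∃ y > 0, every-GS order`).

So the one open stub of line `Sketch`, `stub_freePenalisedFloor` (constructive thermal pair order
of the penalised torus at a free schedule), is equivalent up to the constants `2` and `8` to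
EVERY-ground-state `d`-wave pair LRO `≥ cL⁴` on a window of couplings — strictly stronger than
the crux `BirGroundStateAverageLRO` (ground-state AVERAGE), and the every-GS form the summit needs
at one coupling. The line therefore neither loses nor gains difficulty relative to every-GS order:
its content is the thermal DRESSING of that statement for an engine.

Sources: H. Tasaki (2020) App. A, §2.2; E. H. Lieb, PRL 62 (1989) 1201 (sectors); T. Kato
(1966) §II.5. Folklore; no definition is introduced.
-/

noncomputable section

namespace Summit.HubbardSuperconductivity.HubbardSuperconductivity.Theorems.BirGroundStateAverageLRO.Softmin

open Matrix Finset Filter Topology Literature.MathematicalPhysics.QuantumLattice Literature.Probability.LatticeModels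
open Summit.HubbardSuperconductivity.HubbardSuperconductivity.Theses.BalabanIR
open Summit.HubbardSuperconductivity.HubbardSuperconductivity.Theorems
open scoped ComplexOrder

/-! ## The Hubbard torus: the free socket of line `Sketch` from every-ground-state order -/

section Hubbard

/-- **Penalised sector ground states exist.** For every side `L`, coupling `U`, real `g` and
`m ≤ L²`, the penalised torus Hamiltonian `X = hubbardTorus 2 L 1 U + g·Δ_d†Δ_d` has a
non-trivial ground eigenspace in the joint sector `(N, S^z) = (2m, 0)`: `X` is Hermitian and
block diagonal in the `(N↑, N↓)` sectors (`PreservesSectors`), so `sector_groundState` applies to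
the coordinate subspace `szSector (2m) 0`. Lieb, PRL 62 (1989) 1201; Tasaki (2020) §2.2.
[folklore] -/
theorem penalisedHubbard_groundEigenspace_ne_bot (L : ℕ) [NeZero L] (U g : ℝ) {m : ℕ}
    (hm : m ≤ L ^ 2) :
    szSector (Λ := FermionTorus 2 L) (2 * m) 0 ⊓
        Module.End.eigenspace (Matrix.toLin' (hubbardTorus 2 L 1 U +
          ((g : ℝ) : ℂ) • ((pairField dWaveFormFactor L)ᴴ * pairField dWaveFormFactor L)))
          ((((hubbardTorus 2 L 1 U +
            ((g : ℝ) : ℂ) • ((pairField dWaveFormFactor L)ᴴ * pairField dWaveFormFactor L)).minEnergyOn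
              (szSector (Λ := FermionTorus 2 L) (2 * m) 0) : ℝ) : ℂ)) ≠ ⊥ := by
  classical
  set X : Matrix (Finset (Orb (FermionTorus 2 L))) (Finset (Orb (FermionTorus 2 L))) ℂ :=
    hubbardTorus 2 L 1 U +
      ((g : ℝ) : ℂ) • ((pairField dWaveFormFactor L)ᴴ * pairField dWaveFormFactor L) with hXdef
  have hX : X.IsHermitian :=
    isHermitian_add_real_smul (LiebThm1.hamiltonian_isHermitian (fermionTorusGraph 2 L) 1 U)
      (Matrix.isHermitian_conjTranspose_mul_self _) g
  have hpres : PreservesSectors X :=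
    (LiebThm1.preservesSectors_hamiltonian (fermionTorusGraph 2 L) 1 U).add
      ((preservesSectors_pairField_dWave_conjTranspose_mul_self L).smul _)
  have hcard : m ≤ Fintype.card (FermionTorus 2 L) := by rwa [NoGo.card_fermionTorus_two]
  obtain ⟨α₀, -, hα₀⟩ : ∃ α₀ : Finset (FermionTorus 2 L), α₀ ⊆ univ ∧ α₀.card = m :=
    Finset.exists_subset_card_eq (by rwa [Finset.card_univ])
  have hp : ∃ s : Finset (Orb (FermionTorus 2 L)),
      (upPart s).card = m ∧ (downPart s).card = m :=
    ⟨pairSet α₀ α₀, by rw [upPart_pairSet, hα₀], by rw [downPart_pairSet, hα₀]⟩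
  have hinv : ∀ s s' : Finset (Orb (FermionTorus 2 L)),
      ¬((upPart s).card = m ∧ (downPart s).card = m) →
      ((upPart s').card = m ∧ (downPart s').card = m) → X s s' = 0 := by
    intro s s' hs hs'
    by_contra h
    have := hpres s s' h
    exact hs ⟨this.1.trans hs'.1, this.2.trans hs'.2⟩
  have hK : ∀ v : Fock (Orb (FermionTorus 2 L)),
      v ∈ szSector (Λ := FermionTorus 2 L) (2 * m) (0 : ℝ) ↔
        ∀ s, ¬((upPart s).card = m ∧ (downPart s).card = m) → v s = 0 :=
    fun v => mem_szSector_two_mul_zero_iff m v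
  obtain ⟨⟨v, hv, hv0, hXv⟩, -⟩ :=
    Literature.MathematicalPhysics.QuantumLattice.sector_groundState X hX
      (fun s => (upPart s).card = m ∧ (downPart s).card = m) hp hinv
      (szSector (Λ := FermionTorus 2 L) (2 * m) 0) hK
  rw [Submodule.ne_bot_iff]
  refine ⟨v, Submodule.mem_inf.2 ⟨hv, ?_⟩, hv0⟩
  rw [Module.End.mem_eigenspace_iff, Matrix.toLin'_apply]
  exact hXv

/-- **Every-ground-state `d`-wave order gives the free-socket data (one side, one coupling).**
If every normalised ground state of `hubbardTorus 2 L 1 U` in the sector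
`(2⌊(1-δ)L²/2⌋, S^z = 0)` has `Re⟨ψ, Δ_d†Δ_d ψ⟩ ≥ y L⁴` (`y > 0`, `δ ≥ -1`), then there are
`β > 0`, `κ > 0` and `σ = L² log 4` with `4σ ≤ βκ·(y/8)` and the penalised thermal floor
`(y/8)·L⁴·Re tr(P_S e^{-βK}) ≤ Re tr(P_S e^{-βK} Δ_d†Δ_d)`, `K = H + (κ/L⁴)Δ_d†Δ_d` — i.e. the data
asked by `stub_freePenalisedFloor` / consumed by `transfer_free` at `(U, L)` with floor `y/8`
(`exists_penalisedThermalFloor_of_groundStateFloor` with `A = Δ_d†Δ_d ⪰ 0`, `M = (C_d L²)²`,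
`κ = gL⁴`). [folklore] -/
theorem freeFloorAt_of_everyGroundStateLRO (L : ℕ) [NeZero L] (U δ y : ℝ) (hδ : -1 ≤ δ)
    (hy : 0 < y)
    (hGS : ∀ ψ : Fock (Orb (FermionTorus 2 L)),
      IsGroundStateInSector (hubbardTorus 2 L 1 U) (2 * ⌊(1 - δ) * (L : ℝ) ^ 2 / 2⌋₊) 0 ψ →
      star ψ ⬝ᵥ ψ = 1 →
      y * (L : ℝ) ^ 4 ≤
        (star ψ ⬝ᵥ ((pairField dWaveFormFactor L)ᴴ * pairField dWaveFormFactor L) *ᵥ ψ).re) :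
    let N : ℕ := 2 * ⌊(1 - δ) * (L : ℝ) ^ 2 / 2⌋₊
    let H := hubbardTorus 2 L 1 U
    let S := szSector (Λ := FermionTorus 2 L) N 0
    let P := projMatrix (S.map (Fock.toEuclidean (ι := Orb (FermionTorus 2 L)) :
      Fock (Orb (FermionTorus 2 L)) →ₗ[ℂ] EuclideanSpace ℂ (Finset (Orb (FermionTorus 2 L)))))
    let A := (pairField dWaveFormFactor L)ᴴ * pairField dWaveFormFactor L
    let e : ℝ := H.minEnergyOn S
    ∃ β κ σ : ℝ, 0 < β ∧ 0 < κ ∧ 4 * σ ≤ β * κ * (y / 8) ∧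
      y / 8 * (L : ℝ) ^ 4 * (P * gibbsWeight β (H + ((κ / (L : ℝ) ^ 4 : ℝ) : ℂ) • A)).trace.re ≤
        (P * gibbsWeight β (H + ((κ / (L : ℝ) ^ 4 : ℝ) : ℂ) • A) * A).trace.re ∧
      (Real.log ((P * gibbsWeight β (H - ((e : ℝ) : ℂ) • 1)).trace.re) ≤ σ ∨
        (L : ℝ) ^ 2 * Real.log 4 ≤ σ) := by
  intro N H S P A e
  set m : ℕ := ⌊(1 - δ) * (L : ℝ) ^ 2 / 2⌋₊ with hmdef
  have hmL : m ≤ L ^ 2 := NoGo.floor_pairNumber_le δ hδ L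
  have hmcard : m ≤ Fintype.card (FermionTorus 2 L) := by rwa [NoGo.card_fermionTorus_two]
  have hL : (0 : ℝ) < (L : ℝ) := by exact_mod_cast Nat.pos_of_ne_zero (NeZero.ne L)
  have hL4 : (0 : ℝ) < (L : ℝ) ^ 4 := by positivity
  have hH : H.IsHermitian := LiebThm1.hamiltonian_isHermitian (fermionTorusGraph 2 L) 1 U
  have hA : A.PosSemidef := Matrix.posSemidef_conjTranspose_mul_self _
  have hSH : ∀ v ∈ S, H *ᵥ v ∈ S := fun v hv => hubbardTorus_mulVec_mem_szSector 2 L 1 U m hv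
  have hSA : ∀ v ∈ S, A *ᵥ v ∈ S := fun v hv => pairPenalty_mulVec_mem_szSector L m hv
  have hE₀ := hubbardTorus_groundEigenspace_ne_bot 2 L 1 U hmcard
  have hEg : ∀ g : ℝ, 0 < g → S ⊓ Module.End.eigenspace (Matrix.toLin' (H + ((g : ℝ) : ℂ) • A))
      (((H + ((g : ℝ) : ℂ) • A).minEnergyOn S : ℝ) : ℂ) ≠ ⊥ :=
    fun g _ => penalisedHubbard_groundEigenspace_ne_bot L U g hmL
  -- the norm bound `M = (C_d L²)²`
  set C : ℝ := ∑ e ∈ insert 0 unitSteps, ‖((dWaveFormFactor e / Real.sqrt 2 : ℝ) : ℂ)‖ * 2 with hC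
  have hM : ∀ v : Fock (Orb (FermionTorus 2 L)), (star v ⬝ᵥ (A *ᵥ v)).re ≤
      (C * (L : ℝ) ^ 2) ^ 2 * (star v ⬝ᵥ v).re :=
    fun v => re_expect_pairField_conjTranspose_mul_le dWaveFormFactor L v
  -- the every-ground-state floor, homogeneous on `E₀`
  have hm0 : 0 < y * (L : ℝ) ^ 4 := mul_pos hy hL4
  have hunit : ∀ ψ ∈ S ⊓ Module.End.eigenspace (Matrix.toLin' H) ((H.minEnergyOn S : ℝ) : ℂ),
      star ψ ⬝ᵥ ψ = 1 → y * (L : ℝ) ^ 4 ≤ (star ψ ⬝ᵥ (A *ᵥ ψ)).re :=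
    fun ψ hψ h1 => hGS ψ (isGroundStateInSector_of_mem_inf_eigenspace H (2 * m) 0 hψ h1) h1
  have hm : ∀ ψ ∈ S ⊓ Module.End.eigenspace (Matrix.toLin' H) ((H.minEnergyOn S : ℝ) : ℂ),
      y * (L : ℝ) ^ 4 * (star ψ ⬝ᵥ ψ).re ≤ (star ψ ⬝ᵥ (A *ᵥ ψ)).re :=
    fun ψ hψ => mul_re_le_re_quadForm_of_unit_bound _ hunit ψ hψ
  -- the abstract theorem, with budget `B = 32 log 4 / (L² y)`
  obtain ⟨β, g, hβ, hg, hB, hfl⟩ := exists_penalisedThermalFloor_of_groundStateFloor hH hA S hSH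
    hSA hE₀ hEg hM hm0 hm (32 * Real.log 4 / ((L : ℝ) ^ 2 * y))
  refine ⟨β, g * (L : ℝ) ^ 4, (L : ℝ) ^ 2 * Real.log 4, hβ, mul_pos hg hL4, ?_, ?_, Or.inr le_rfl⟩
  · -- budget: `4 L² log 4 ≤ β (g L⁴) (y/8)` from `32 log 4/(L² y) ≤ β g`
    rw [div_le_iff₀ (by positivity)] at hB
    nlinarith [hB, hL4]
  · have hk : g * (L : ℝ) ^ 4 / (L : ℝ) ^ 4 = g := by field_simp
    rw [hk]
    have h8 : y / 8 * (L : ℝ) ^ 4 = y * (L : ℝ) ^ 4 / 8 := by ring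
    rw [h8]
    exact hfl

/-- **Every-ground-state order on the window ⇒ the free-socket data on the window.** The inner
statement of the engine stub `stub_freePenalisedFloor` of line `Sketch` (floor `x = y/8`)
follows from every-ground-state `d`-wave pair order `≥ y L⁴` on the window, eventually in even
`L`. With `everyGroundStateLRO_of_freeFloorWindow` (the landed transfer direction, floor
`x ↦ x/2`): the engine socket of line `Sketch` is equivalent, up to the constants `2` and `8`,
to every-ground-state `d`-wave pair LRO on a window of couplings. [folklore] -/
theorem freeFloorWindow_of_everyGroundStateLRO (δ U₁ U₂ y : ℝ) (hδ : δ ∈ Set.Ioo (0 : ℝ) (1 / 2))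
    (hy : 0 < y)
    (h : ∀ U ∈ Set.Ioo U₁ U₂, ∃ L₀ : ℕ, ∀ (L : ℕ) [NeZero L], L₀ ≤ L → Even L →
      ∀ ψ : Fock (Orb (FermionTorus 2 L)),
        IsGroundStateInSector (hubbardTorus 2 L 1 U) (2 * ⌊(1 - δ) * (L : ℝ) ^ 2 / 2⌋₊) 0 ψ →
        star ψ ⬝ᵥ ψ = 1 →
        y * (L : ℝ) ^ 4 ≤
          (star ψ ⬝ᵥ ((pairField dWaveFormFactor L)ᴴ * pairField dWaveFormFactor L) *ᵥ ψ).re) :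
    ∀ U ∈ Set.Ioo U₁ U₂, ∃ L₀ : ℕ, ∀ (L : ℕ) [NeZero L], L₀ ≤ L → Even L →
      let N : ℕ := 2 * ⌊(1 - δ) * (L : ℝ) ^ 2 / 2⌋₊
      let H := hubbardTorus 2 L 1 U
      let S := szSector (Λ := FermionTorus 2 L) N 0
      let P := projMatrix (S.map (Fock.toEuclidean (ι := Orb (FermionTorus 2 L)) :
        Fock (Orb (FermionTorus 2 L)) →ₗ[ℂ] EuclideanSpace ℂ (Finset (Orb (FermionTorus 2 L)))))
      let A := (pairField dWaveFormFactor L)ᴴ * pairField dWaveFormFactor L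
      let e : ℝ := H.minEnergyOn S
      ∃ β κ σ : ℝ, 0 < β ∧ 0 < κ ∧ 4 * σ ≤ β * κ * (y / 8) ∧
        y / 8 * (L : ℝ) ^ 4 * (P * gibbsWeight β (H + ((κ / (L : ℝ) ^ 4 : ℝ) : ℂ) • A)).trace.re ≤
          (P * gibbsWeight β (H + ((κ / (L : ℝ) ^ 4 : ℝ) : ℂ) • A) * A).trace.re ∧
        (Real.log ((P * gibbsWeight β (H - ((e : ℝ) : ℂ) • 1)).trace.re) ≤ σ ∨
          (L : ℝ) ^ 2 * Real.log 4 ≤ σ) := by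
  intro U hU
  obtain ⟨L₀, hL₀⟩ := h U hU
  refine ⟨L₀, fun L _ hL hLe => ?_⟩
  exact freeFloorAt_of_everyGroundStateLRO L U δ y (by linarith [hδ.1]) hy (hL₀ L hL hLe)

/-- **The free-socket data on the window ⇒ every-ground-state order on the window** (the landed
direction, `everyGroundState_of_freeFloorAt`, at the window level: floor `x ↦ x/2`). [folklore] -/
theorem everyGroundStateLRO_of_freeFloorWindow (δ U₁ U₂ x : ℝ) (hx : 0 < x)
    (h : ∀ U ∈ Set.Ioo U₁ U₂, ∃ L₀ : ℕ, ∀ (L : ℕ) [NeZero L], L₀ ≤ L → Even L →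
      let N : ℕ := 2 * ⌊(1 - δ) * (L : ℝ) ^ 2 / 2⌋₊
      let H := hubbardTorus 2 L 1 U
      let S := szSector (Λ := FermionTorus 2 L) N 0
      let P := projMatrix (S.map (Fock.toEuclidean (ι := Orb (FermionTorus 2 L)) :
        Fock (Orb (FermionTorus 2 L)) →ₗ[ℂ] EuclideanSpace ℂ (Finset (Orb (FermionTorus 2 L)))))
      let A := (pairField dWaveFormFactor L)ᴴ * pairField dWaveFormFactor L
      let e : ℝ := H.minEnergyOn S
      ∃ β κ σ : ℝ, 0 < β ∧ 0 < κ ∧ 4 * σ ≤ β * κ * x ∧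
        x * (L : ℝ) ^ 4 * (P * gibbsWeight β (H + ((κ / (L : ℝ) ^ 4 : ℝ) : ℂ) • A)).trace.re ≤
          (P * gibbsWeight β (H + ((κ / (L : ℝ) ^ 4 : ℝ) : ℂ) • A) * A).trace.re ∧
        (Real.log ((P * gibbsWeight β (H - ((e : ℝ) : ℂ) • 1)).trace.re) ≤ σ ∨
          (L : ℝ) ^ 2 * Real.log 4 ≤ σ)) :
    ∀ U ∈ Set.Ioo U₁ U₂, ∃ L₀ : ℕ, ∀ (L : ℕ) [NeZero L], L₀ ≤ L → Even L →
      ∀ ψ : Fock (Orb (FermionTorus 2 L)),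
        IsGroundStateInSector (hubbardTorus 2 L 1 U) (2 * ⌊(1 - δ) * (L : ℝ) ^ 2 / 2⌋₊) 0 ψ →
        star ψ ⬝ᵥ ψ = 1 →
        x / 2 * (L : ℝ) ^ 4 ≤
          (star ψ ⬝ᵥ ((pairField dWaveFormFactor L)ᴴ * pairField dWaveFormFactor L) *ᵥ ψ).re := by
  intro U hU
  obtain ⟨L₀, hL₀⟩ := h U hU
  refine ⟨L₀, fun L _ hL hLe => ?_⟩
  obtain ⟨β, κ, σ, hβ, hκ, hbudget, hfl, hσ⟩ := hL₀ L hL hLe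
  exact everyGroundState_of_freeFloorAt L U δ κ x β σ hκ hx hβ hbudget hfl hσ

/-- **The engine socket of line `Sketch` IS every-ground-state `d`-wave order (window level, existential
constants).** For `δ ∈ (0,1/2)` and a window `(U₁, U₂)`: the data of `stub_freePenalisedFloor` hold
for SOME floor `x > 0` iff every-ground-state `d`-wave pair order `≥ yL⁴` holds for SOME `y > 0`
(both: for every `U` in the window, eventually in even `L`). (`⇒`: `x ↦ x/2`,
`everyGroundStateLRO_of_freeFloorWindow`; `⇐`: `y ↦ y/8`, `freeFloorWindow_of_everyGroundStateLRO`.)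
[folklore] -/
theorem exists_freeFloorWindow_iff_exists_everyGroundStateLRO (δ U₁ U₂ : ℝ)
    (hδ : δ ∈ Set.Ioo (0 : ℝ) (1 / 2)) :
    (∃ x : ℝ, 0 < x ∧ ∀ U ∈ Set.Ioo U₁ U₂, ∃ L₀ : ℕ, ∀ (L : ℕ) [NeZero L], L₀ ≤ L → Even L →
      let N : ℕ := 2 * ⌊(1 - δ) * (L : ℝ) ^ 2 / 2⌋₊
      let H := hubbardTorus 2 L 1 U
      let S := szSector (Λ := FermionTorus 2 L) N 0
      let P := projMatrix (S.map (Fock.toEuclidean (ι := Orb (FermionTorus 2 L)) :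
        Fock (Orb (FermionTorus 2 L)) →ₗ[ℂ] EuclideanSpace ℂ (Finset (Orb (FermionTorus 2 L)))))
      let A := (pairField dWaveFormFactor L)ᴴ * pairField dWaveFormFactor L
      let e : ℝ := H.minEnergyOn S
      ∃ β κ σ : ℝ, 0 < β ∧ 0 < κ ∧ 4 * σ ≤ β * κ * x ∧
        x * (L : ℝ) ^ 4 * (P * gibbsWeight β (H + ((κ / (L : ℝ) ^ 4 : ℝ) : ℂ) • A)).trace.re ≤
          (P * gibbsWeight β (H + ((κ / (L : ℝ) ^ 4 : ℝ) : ℂ) • A) * A).trace.re ∧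
        (Real.log ((P * gibbsWeight β (H - ((e : ℝ) : ℂ) • 1)).trace.re) ≤ σ ∨
          (L : ℝ) ^ 2 * Real.log 4 ≤ σ)) ↔
    (∃ y : ℝ, 0 < y ∧ ∀ U ∈ Set.Ioo U₁ U₂, ∃ L₀ : ℕ, ∀ (L : ℕ) [NeZero L], L₀ ≤ L → Even L →
      ∀ ψ : Fock (Orb (FermionTorus 2 L)),
        IsGroundStateInSector (hubbardTorus 2 L 1 U) (2 * ⌊(1 - δ) * (L : ℝ) ^ 2 / 2⌋₊) 0 ψ →
        star ψ ⬝ᵥ ψ = 1 →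
        y * (L : ℝ) ^ 4 ≤
          (star ψ ⬝ᵥ ((pairField dWaveFormFactor L)ᴴ * pairField dWaveFormFactor L) *ᵥ ψ).re) := by
  constructor
  · rintro ⟨x, hx, h⟩
    exact ⟨x / 2, by positivity, everyGroundStateLRO_of_freeFloorWindow δ U₁ U₂ x hx h⟩
  · rintro ⟨y, hy, h⟩
    exact ⟨y / 8, by positivity, freeFloorWindow_of_everyGroundStateLRO δ U₁ U₂ y hδ hy h⟩

end Hubbard

end Summit.HubbardSuperconductivity.HubbardSuperconductivity.Theorems.BirGroundStateAverageLRO.Softmin
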